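import Literature.NumberTheory.GaloisRepresentations.RootsOfUnityInverseLimit
import Literature.AnabelianGeometry.AbsoluteAnabelian.GaloisCyclotomeMLFHolds
import Literature.AnabelianGeometry.AbsoluteAnabelian.AbsTopIII.CyclotomicSynchronization
import Literature.NumberTheory.GaloisRepresentations.ContinuousCohomologyVanishing
import HarnessLib

/-!
# `μ_Ẑ(G_k) ≅ Ẑ(1)(k̄)`: abc-iut-L4-t1's group-theoretic cyclotome is the Tate module of `k̄`, as topological representations

Mochizuki, *Topics in Absolute Anabelian Geometry III*, Cor. 1.10 (i) p. 42 (kurims `paper:url-5493eb38cbb7`):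
the Galois cyclotome `μ_Ẑ(G_k) = Hom(ℚ/ℤ, lim_H (H^ab)_tors)` of an MLF `k` "is" `Ẑ(1)`.  In the tree:
`galCyclotomeTopRep G` (abc-iut-L4-t1, `CyclotomicSynchronization.lean`; `MuZhatMod G` with its profinite
topology and conjugation action) and the Tate module `tateModuleMu k = lim_n μ_n(k̄)` of
`RootsOfUnityInverseLimit.lean`.  This file constructs, from any `G_k`-EQUIVARIANT additive isomorphism
`φ : μ_{ℚ/ℤ}(G_k) ≅ μ(k̄)` — the DISCHARGED fact `MLFGaloisCyclotomeIsRootsOfUnity` ([AbsAnab] Prop. 1.2.1 (vi),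
`mlfGaloisCyclotomeIsRootsOfUnity_holds`) — the isomorphism

* `galCyclotomeIsoTateModule k φ hφ : galCyclotomeTopRep G_k ≅ (tateModuleMu k).toTopRep` in Mathlib's
  `TopRep ℤ G_k` (levelwise: the `n`-th coordinate of `ζ ∈ μ_Ẑ(G_k)` is an `n`-torsion class, `φ` of it an
  `n`-th root of unity; continuity through the discrete levels; equivariance = that of `φ`),

through which the continuous cohomology of `μ_Ẑ(G_k)` in any degree is that of `Ẑ(1)`
(`continuousCohomologyEquivOfIso`).  Consumers: the closers of [AbsTopIII] Cor. 1.10 (i)(a) (abc-iut-L4-t17,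
`CyclotomicSynchronizationCor110iaProofs.lean`, its own route) / (i)(b) (`GaloisCyclotomeH1Proofs.lean`).
Definitions with bodies and theorems; no named fact, no `sorry`.  Nothing here bears on [IUTchIII] Cor. 3.12.
-/

noncomputable section

open CategoryTheory Function
open Field IsNonarchimedeanLocalField ValuativeRel

universe u

namespace Literature.AnabelianGeometry.AbsoluteAnabelian

open _root_.TopRep _root_.ContRepresentation _root_.ContinuousCohomology
open Literature.NumberTheory.GaloisRepresentations
open Literature.NumberTheory.GaloisRepresentations.DiscreteGaloisModule

/-! ### `μ_Ẑ(G_k) ≅ Ẑ(1)(k̄)` as topological representations -/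

section Transport

variable (k : Type u) [Field k] [CharZero k]
variable (φ : muQZ (absoluteGaloisGroup k) ≃+ Additive (CommGroup.torsion (AlgebraicClosure k)ˣ))

/-- The unit of `k̄` at level `n` of an element of `μ_Ẑ(G_k)`, read through `φ : μ_{ℚ/ℤ}(G_k) ≅ μ(k̄)`.
[cite: MochizukiAbsTopIII2015, Cor 1.10 (i) p.42] -/
def levelUnit (m : MuZhatMod (absoluteGaloisGroup k)) (n : ℕ+) : (AlgebraicClosure k)ˣ :=
  ((Additive.toMul (φ (Multiplicative.toAdd ((m.toMuZhat : ℕ+ → Multiplicative (muQZ _)) n))) :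
    CommGroup.torsion (AlgebraicClosure k)ˣ) : (AlgebraicClosure k)ˣ)

/-- `φ` read on `Multiplicative (μ_{ℚ/ℤ})` with values in `k̄ˣ` is multiplicative.
[cite: MochizukiAbsTopIII2015, Cor 1.10 (i) p.42] -/
private theorem coe_toMul_phi_mul_aux (x y : Multiplicative (muQZ (absoluteGaloisGroup k))) :
    ((Additive.toMul (φ (Multiplicative.toAdd (x * y))) : CommGroup.torsion (AlgebraicClosure k)ˣ) :
        (AlgebraicClosure k)ˣ) =
      ((Additive.toMul (φ (Multiplicative.toAdd x)) : CommGroup.torsion (AlgebraicClosure k)ˣ) :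
        (AlgebraicClosure k)ˣ) *
      ((Additive.toMul (φ (Multiplicative.toAdd y)) : CommGroup.torsion (AlgebraicClosure k)ˣ) :
        (AlgebraicClosure k)ˣ) := by
  rw [toAdd_mul, map_add, toMul_add, Subgroup.coe_mul]

/-- `φ` read with values in `k̄ˣ` takes powers to powers. [cite: MochizukiAbsTopIII2015, Cor 1.10 (i) p.42] -/
private theorem coe_toMul_phi_pow_aux (x : Multiplicative (muQZ (absoluteGaloisGroup k))) (d : ℕ) :
    ((Additive.toMul (φ (Multiplicative.toAdd (x ^ d))) : CommGroup.torsion (AlgebraicClosure k)ˣ) :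
        (AlgebraicClosure k)ˣ) =
      ((Additive.toMul (φ (Multiplicative.toAdd x)) : CommGroup.torsion (AlgebraicClosure k)ˣ) :
        (AlgebraicClosure k)ˣ) ^ d := by
  rw [toAdd_pow, map_nsmul, toMul_nsmul, Subgroup.coe_pow]

/-- The level-`n` unit is an `n`-th root of unity. [cite: MochizukiAbsTopIII2015, Cor 1.10 (i) p.42] -/
theorem levelUnit_pow (m : MuZhatMod (absoluteGaloisGroup k)) (n : ℕ+) :
    levelUnit k φ m n ^ (n : ℕ) = 1 := by
  unfold levelUnit
  rw [← coe_toMul_phi_pow_aux, ((mem_muZhat_iff _ _).1 m.toMuZhat.2).1 n, toAdd_one, map_zero,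
    toMul_zero, Subgroup.coe_one]

/-- Compatibility of the level units under the power maps: `(u_m)^{m/n} = u_n` for `n ∣ m`.
[cite: MochizukiAbsTopIII2015, Cor 1.10 (i) p.42] -/
theorem levelUnit_pow_div (x : MuZhatMod (absoluteGaloisGroup k)) {n m : ℕ+} (h : (n : ℕ) ∣ m) :
    levelUnit k φ x m ^ ((m : ℕ) / n) = levelUnit k φ x n := by
  obtain ⟨d, hd⟩ := h
  have hdpos : 0 < d := Nat.pos_of_ne_zero fun h0 => by simp [h0] at hd
  have hm : m = n * ⟨d, hdpos⟩ := PNat.eq hd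
  subst hm
  unfold levelUnit
  rw [← coe_toMul_phi_pow_aux, PNat.mul_coe, PNat.mk_coe, Nat.mul_div_cancel_left d n.pos]
  exact congrArg _ (congrArg _ (congrArg _ (congrArg _
    (((mem_muZhat_iff _ _).1 x.toMuZhat.2).2 n ⟨d, hdpos⟩))))

/-- **`μ_Ẑ(G_k) → Ẑ(1)(k̄) = lim_n μ_n(k̄)`**, levelwise through `φ`, as an additive map.
[cite: MochizukiAbsTopIII2015, Cor 1.10 (i) p.42] -/
def toTateModule : MuZhatMod (absoluteGaloisGroup k) →+ (muSystem k).limit where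
  toFun m := ⟨fun n => muOfUnit k n (levelUnit k φ m n) (levelUnit_pow k φ m n), fun n m' h =>
    muVal_injective k n (by
      rw [muSystem_red, muVal_muPowMap, muVal_muOfUnit, muVal_muOfUnit, levelUnit_pow_div k φ _ h])⟩
  map_zero' := Subtype.ext (funext fun n => muVal_injective k n (by
    change levelUnit k φ 0 n = muVal k n 0
    rw [muVal_zero]
    change ((Additive.toMul (φ (Multiplicative.toAdd 1)) : CommGroup.torsion _) : (AlgebraicClosure k)ˣ) = 1
    rw [toAdd_one, map_zero, toMul_zero, Subgroup.coe_one]))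
  map_add' x y := Subtype.ext (funext fun n => muVal_injective k n (by
    change levelUnit k φ (x + y) n = muVal k n (muOfUnit k n _ (levelUnit_pow k φ x n) +
      muOfUnit k n _ (levelUnit_pow k φ y n))
    rw [muVal_add, muVal_muOfUnit, muVal_muOfUnit]
    exact coe_toMul_phi_mul_aux k φ _ _))

/-- Levels of `toTateModule`. [cite: MochizukiAbsTopIII2015, Cor 1.10 (i) p.42] -/
@[simp] theorem muVal_toTateModule (m : MuZhatMod (absoluteGaloisGroup k)) (n : ℕ+) :
    muVal k n ((toTateModule k φ m : ∀ n : ℕ+, MuCarrier k n) n) = levelUnit k φ m n := rfl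

/-- The torsion unit underlying a root of unity. [cite: MochizukiAbsTopIII2015, Cor 1.10 (i) p.42] -/
def torsionOfMu {n : ℕ+} (v : MuCarrier k n) : CommGroup.torsion (AlgebraicClosure k)ˣ :=
  ⟨muVal k n v, isOfFinOrder_iff_pow_eq_one.2 ⟨n, n.pos, muVal_pow_eq_one k n v⟩⟩

/-- The `Multiplicative (μ_{ℚ/ℤ}(G_k))`-coordinate of a root of unity, through `φ⁻¹`.
[cite: MochizukiAbsTopIII2015, Cor 1.10 (i) p.42] -/
def coordOfMu {n : ℕ+} (v : MuCarrier k n) : Multiplicative (muQZ (absoluteGaloisGroup k)) :=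
  Multiplicative.ofAdd (φ.symm (Additive.ofMul (torsionOfMu k v)))

/-- `φ` undoes `coordOfMu`. [cite: MochizukiAbsTopIII2015, Cor 1.10 (i) p.42] -/
theorem coe_toMul_phi_coordOfMu {n : ℕ+} (v : MuCarrier k n) :
    ((Additive.toMul (φ (Multiplicative.toAdd (coordOfMu k φ v))) :
      CommGroup.torsion (AlgebraicClosure k)ˣ) : (AlgebraicClosure k)ˣ) = muVal k n v := by
  unfold coordOfMu
  rw [toAdd_ofAdd, φ.apply_symm_apply, toMul_ofMul]
  rfl

/-- Injectivity of "`φ` read with values in `k̄ˣ`". [cite: MochizukiAbsTopIII2015, Cor 1.10 (i) p.42] -/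
theorem toAdd_injective_of_coe (x y : Multiplicative (muQZ (absoluteGaloisGroup k)))
    (h : ((Additive.toMul (φ (Multiplicative.toAdd x)) : CommGroup.torsion (AlgebraicClosure k)ˣ) :
        (AlgebraicClosure k)ˣ) =
      ((Additive.toMul (φ (Multiplicative.toAdd y)) : CommGroup.torsion (AlgebraicClosure k)ˣ) :
        (AlgebraicClosure k)ˣ)) : x = y :=
  Multiplicative.toAdd.injective (φ.injective (Additive.toMul.injective (Subtype.ext h)))

/-- **`Ẑ(1)(k̄) → μ_Ẑ(G_k)`**, levelwise through `φ⁻¹` (the inverse of `toTateModule`).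
[cite: MochizukiAbsTopIII2015, Cor 1.10 (i) p.42] -/
def ofTateModule (x : (muSystem k).limit) : MuZhatMod (absoluteGaloisGroup k) :=
  MuZhatMod.ofMuZhat ⟨fun n => coordOfMu k φ ((x : ∀ n : ℕ+, MuCarrier k n) n),
    (mem_muZhat_iff _ _).2 ⟨fun n => toAdd_injective_of_coe k φ _ _ (by
      rw [coe_toMul_phi_pow_aux, coe_toMul_phi_coordOfMu, muVal_pow_eq_one, toAdd_one, map_zero, toMul_zero,
        Subgroup.coe_one]), fun n m => toAdd_injective_of_coe k φ _ _ (by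
      rw [coe_toMul_phi_pow_aux, coe_toMul_phi_coordOfMu, coe_toMul_phi_coordOfMu]
      have h := congrArg (muVal k n) ((muSystem k).red_apply_coe x
        (show (muSystem k).le n (n * m) from dvd_mul_right (n : ℕ) m))
      have hd : ((n * m : ℕ+) : ℕ) / n = m := by rw [PNat.mul_coe, Nat.mul_div_cancel_left _ n.pos]
      rw [muSystem_red, muVal_muPowMap, hd] at h
      exact h)⟩⟩

/-- `ofTateModule` is a left inverse of `toTateModule`. [cite: MochizukiAbsTopIII2015, Cor 1.10 (i) p.42] -/
theorem ofTateModule_toTateModule (m : MuZhatMod (absoluteGaloisGroup k)) :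
    ofTateModule k φ (toTateModule k φ m) = m := by
  apply Additive.toMul.injective
  refine Subtype.ext (funext fun n => toAdd_injective_of_coe k φ _ _ ?_)
  change ((Additive.toMul (φ (Multiplicative.toAdd (coordOfMu k φ _))) : CommGroup.torsion _) :
    (AlgebraicClosure k)ˣ) = _
  rw [coe_toMul_phi_coordOfMu, muVal_toTateModule]
  rfl

/-- `ofTateModule` is a right inverse of `toTateModule`. [cite: MochizukiAbsTopIII2015, Cor 1.10 (i) p.42] -/
theorem toTateModule_ofTateModule (x : (muSystem k).limit) :
    toTateModule k φ (ofTateModule k φ x) = x := by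
  refine Subtype.ext (funext fun n => muVal_injective k n ?_)
  rw [muVal_toTateModule]
  exact coe_toMul_phi_coordOfMu k φ _

/-- Truncated `muOfUnit`: a unit with `u^n = 1` as an element of `μ_n`, else `0` (a total function, for
continuity bookkeeping). [cite: MochizukiAbsTopIII2015, Cor 1.10 (i) p.42] -/
def muOfUnitTrunc (n : ℕ+) (u : (AlgebraicClosure k)ˣ) : MuCarrier k n := by
  classical
  exact if h : u ^ (n : ℕ) = 1 then muOfUnit k n u h else 0

omit [CharZero k] in
/-- `muOfUnitTrunc` agrees with `muOfUnit` on roots of unity. [cite: MochizukiAbsTopIII2015, Cor 1.10 (i) p.42] -/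
theorem muOfUnitTrunc_eq (n : ℕ+) (u : (AlgebraicClosure k)ˣ) (h : u ^ (n : ℕ) = 1) :
    muOfUnitTrunc k n u = muOfUnit k n u h := by
  classical
  exact dif_pos h

/-- `toTateModule` is continuous (levelwise through the discrete `μ_{ℚ/ℤ}(G_k)`).
[cite: MochizukiAbsTopIII2015, Cor 1.10 (i) p.42] -/
theorem continuous_toTateModule : Continuous (toTateModule k φ) := by
  refine continuous_induced_rng.2 (continuous_pi fun n => ?_)
  refine ((continuous_of_discreteTopology (f := fun x : Multiplicative (muQZ (absoluteGaloisGroup k)) =>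
    muOfUnitTrunc k n ((Additive.toMul (φ (Multiplicative.toAdd x)) :
      CommGroup.torsion (AlgebraicClosure k)ˣ) : (AlgebraicClosure k)ˣ))).comp
    (MuZhatMod.continuous_apply n)).congr fun m => ?_
  exact muOfUnitTrunc_eq k n _ (levelUnit_pow k φ m n)

/-- `ofTateModule` is continuous (levelwise through the discrete `μ_n`). [cite: MochizukiAbsTopIII2015, Cor 1.10 (i) p.42] -/
theorem continuous_ofTateModule : Continuous (ofTateModule k φ) := by
  refine continuous_induced_rng.2 (continuous_pi fun n => ?_)
  exact (continuous_of_discreteTopology (f := fun v : MuCarrier k n => coordOfMu k φ v)).comp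
    ((continuous_apply n).comp continuous_subtype_val)

/-- **`μ_Ẑ(G_k) ≃ Ẑ(1)(k̄)`** as topological `ℤ`-modules. [cite: MochizukiAbsTopIII2015, Cor 1.10 (i) p.42] -/
def tateModuleEquiv : MuZhatMod (absoluteGaloisGroup k) ≃L[ℤ] (muSystem k).limit :=
  { (toTateModule k φ).toIntLinearMap with
    invFun := ofTateModule k φ
    left_inv := ofTateModule_toTateModule k φ
    right_inv := toTateModule_ofTateModule k φ
    continuous_toFun := continuous_toTateModule k φ
    continuous_invFun := continuous_ofTateModule k φ }

/-- `tateModuleEquiv` on elements. [cite: MochizukiAbsTopIII2015, Cor 1.10 (i) p.42] -/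
@[simp] theorem tateModuleEquiv_apply (m : MuZhatMod (absoluteGaloisGroup k)) :
    tateModuleEquiv k φ m = toTateModule k φ m := rfl

variable [CompactSpace (absoluteGaloisGroup k)]

/-- **`μ_Ẑ(G_k) ≅ Ẑ(1)(k̄)` in `TopRep ℤ G_k`** when `φ : μ_{ℚ/ℤ}(G_k) ≅ μ(k̄)` is `G_k`-EQUIVARIANT (the
discharged fact `MLFGaloisCyclotomeIsRootsOfUnity`, [AbsAnab] Prop. 1.2.1 (vi)): abc-iut-L4-t1's
group-theoretic cyclotome `galCyclotomeTopRep G_k` is isomorphic to the Tate module of `k̄`.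
[cite: MochizukiAbsTopIII2015, Cor 1.10 (i) p.42] -/
def galCyclotomeIsoTateModule
    (hφ : ∀ (σ : absoluteGaloisGroup k) (x : muQZ (absoluteGaloisGroup k)),
      (((Additive.toMul (φ (σ • x)) : CommGroup.torsion (AlgebraicClosure k)ˣ) :
          (AlgebraicClosure k)ˣ) : AlgebraicClosure k) =
        σ • (((Additive.toMul (φ x) : CommGroup.torsion (AlgebraicClosure k)ˣ) :
          (AlgebraicClosure k)ˣ) : AlgebraicClosure k)) :
    galCyclotomeTopRep (absoluteGaloisGroup k) ≅ (tateModuleMu k).toTopRep :=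
  topRepIsoOfEquiv (tateModuleEquiv k φ) fun g x => by
    refine Subtype.ext (funext fun n => muVal_injective k n (Units.ext ?_))
    change ((levelUnit k φ (MuZhatMod.act _ g x) n : (AlgebraicClosure k)ˣ) : AlgebraicClosure k) =
      ((g • levelUnit k φ x n : (AlgebraicClosure k)ˣ) : AlgebraicClosure k)
    exact hφ g (Multiplicative.toAdd ((MuZhatMod.toMuZhat x : ℕ+ → Multiplicative (muQZ _)) n))

end Transport

end Literature.AnabelianGeometry.AbsoluteAnabelian
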